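import Mathlib
import HarnessLib

/-!
# The sample size required in importance sampling (Chatterjee–Diaconis 2018, Theorem 1.1)

Setting [cite: ChatterjeeDiaconis2018, §1]: `μ` and `ν` are probability measures on a measurable
space `𝓧`, `ν ≪ μ` with density `ρ = dν/dμ`; `X₁, X₂, …` are i.i.d. with law `μ`; for a
measurable `f : 𝓧 → ℝ` the importance-sampling estimate of `I(f) = ∫ f dν` from the first `n`
draws is `I_n(f) = (1/n) Σ_{i ≤ n} f(X_i) ρ(X_i)`.  With `Y ∼ ν`,
`L = D(ν‖μ) = ∫ ρ log ρ dμ = ∫ log ρ dν = 𝔼 log ρ(Y)` (Kullback–Leibler divergence, natural log)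
and `‖f‖_{L²(ν)} = (𝔼 f(Y)²)^{1/2}`.

**Theorem 1.1** [cite: ChatterjeeDiaconis2018, Thm 1.1] (verbatim up to notation).
If `n = exp(L + t)` for some `t ≥ 0`, then
`𝔼 |I_n(f) − I(f)| ≤ ‖f‖_{L²(ν)} · (e^{−t/4} + 2 · √(ℙ(log ρ(Y) > L + t/2)))`.
Conversely, with `1` the constant function, if `n = exp(L − t)` for some `t ≥ 0`, then for any
`δ ∈ (0, 1)`,  `ℙ(I_n(1) ≥ 1 − δ) ≤ e^{−t/2} + ℙ(log ρ(Y) ≤ L − t/2) / (1 − δ)`.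

"The theorem says that the sample size `n` required for `I_n(f)` to be close to `I(f)` with high
probability is roughly `exp(D(ν‖μ))`."  (Used by the venture `LatticeQCDFlow`, cell pub-lqcd, to
price reweighting-mode flow samplers: `n ≈ exp(D_KL(p‖q))` independent model draws are necessary
and sufficient.)

Typing notes.  (i) The printed `n = exp(L ± t)` is not an integer in general; the printed proof
(§4 "Proofs" of the paper: truncation of `f` at `ρ ≤ e^{L + t/2}`, a variance bound `∝ 1/n`, and a
union bound `n · μ(ρ > a)`) uses only `n ≥ exp(L + t)` in the first part and `n ≤ exp(L − t)` in
the second, which is how the hypotheses are typed below — the statement with equality is the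
special case.  (ii) The i.i.d. sample of size `n` is realised canonically as the product measure
`Measure.pi (fun _ : Fin n => μ)` on `Fin n → 𝓧`.  (iii) `‖f‖_{L²(ν)} < ∞` is the paper's standing
assumption for the first display to have content; it is the hypothesis `MemLp f 2 ν`.
(iv) `ρ` is Mathlib's Radon–Nikodym derivative `ν.rnDeriv μ`, read in `ℝ` via `toReal`
(it is `μ`-a.e. finite).  The named fact is PROVED in this file
(`ChatterjeeDiaconis2018_sampleSize_holds`, section `Proof` below, which follows the printed proof
step by step); the venture's finite-space consequences are proved under
`Summits/Ventures/LatticeQCDFlow/Scaling/`.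
-/

namespace Literature.Probability.ImportanceSampling

open _root_.MeasureTheory

universe u

variable {𝓧 : Type u} [MeasurableSpace 𝓧]

/-- The importance-sampling estimate `I_n(f)(x) = (1/n) Σ_{i<n} f(x i) · ρ(x i)` of `∫ f dν`
computed from an `n`-sample `x : Fin n → 𝓧`, with `ρ = dν/dμ` (Mathlib's `ν.rnDeriv μ`, in `ℝ`)
[cite: ChatterjeeDiaconis2018, §1]. For `n = 0` it is `0` (empty sample). -/
noncomputable def isEstimate (μ ν : Measure 𝓧) (f : 𝓧 → ℝ) (n : ℕ) (x : Fin n → 𝓧) : ℝ :=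
  (1 / (n : ℝ)) * ∑ i, f (x i) * (ν.rnDeriv μ (x i)).toReal

/-- For the constant function `1` the estimate is the mean weight `I_n(1) = (1/n) Σ_i ρ(x i)`,
the quantity whose deviation from `1` the second half of the theorem controls
[cite: ChatterjeeDiaconis2018, §1 (definition of `I_n(f)`) and Thm 1.1 (second display)]. -/
theorem isEstimate_const_one (μ ν : Measure 𝓧) (n : ℕ) (x : Fin n → 𝓧) :
    isEstimate μ ν (fun _ => (1 : ℝ)) n x = (1 / (n : ℝ)) * ∑ i, (ν.rnDeriv μ (x i)).toReal := by
  simp [isEstimate]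

/-- **Chatterjee–Diaconis sample-size theorem** [cite: ChatterjeeDiaconis2018, Thm 1.1], as
printed (both parts), for probability measures `ν ≪ μ` on a measurable space, with
`ρ = dν/dμ`, `L = ∫ log ρ dν = D(ν‖μ)`, `‖f‖ = (∫ f² dν)^{1/2}`, the `n`-sample drawn from
`μ^{⊗ n}`:
* sufficiency: `t ≥ 0`, `n ≥ e^{L + t}` ⇒
  `∫ |I_n(f) − ∫ f dν| dμ^{⊗n} ≤ ‖f‖ · (e^{−t/4} + 2 √(ν{log ρ > L + t/2}))`;
* necessity: `t ≥ 0`, `n ≤ e^{L − t}`, `δ ∈ (0,1)` ⇒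
  `μ^{⊗n}{I_n(1) ≥ 1 − δ} ≤ e^{−t/2} + ν{log ρ ≤ L − t/2} / (1 − δ)`. -/
def ChatterjeeDiaconis2018_sampleSize : Prop :=
  ∀ (𝓧 : Type u) [MeasurableSpace 𝓧] (μ ν : Measure 𝓧) [IsProbabilityMeasure μ]
    [IsProbabilityMeasure ν], ν ≪ μ →
    ∀ (f : 𝓧 → ℝ), Measurable f → MemLp f 2 ν →
    ∀ (t : ℝ), 0 ≤ t →
      (∀ n : ℕ, Real.exp ((∫ y, Real.log (ν.rnDeriv μ y).toReal ∂ν) + t) ≤ (n : ℝ) →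
          ∫ x, |isEstimate μ ν f n x - ∫ y, f y ∂ν| ∂(Measure.pi fun _ : Fin n => μ) ≤
            Real.sqrt (∫ y, f y ^ 2 ∂ν) *
              (Real.exp (-t / 4) +
                2 * Real.sqrt (ν {y | (∫ z, Real.log (ν.rnDeriv μ z).toReal ∂ν) + t / 2 <
                      Real.log (ν.rnDeriv μ y).toReal}).toReal)) ∧
      (∀ n : ℕ, (n : ℝ) ≤ Real.exp ((∫ y, Real.log (ν.rnDeriv μ y).toReal ∂ν) - t) →
          ∀ δ : ℝ, 0 < δ → δ < 1 →
            ((Measure.pi fun _ : Fin n => μ)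
                {x | 1 - δ ≤ isEstimate μ ν (fun _ => (1 : ℝ)) n x}).toReal ≤
              Real.exp (-t / 2) +
                (ν {y | Real.log (ν.rnDeriv μ y).toReal ≤
                      (∫ z, Real.log (ν.rnDeriv μ z).toReal ∂ν) - t / 2}).toReal / (1 - δ))


/-! ## Proof of Theorem 1.1 (discharge of the named fact)

The formal proof follows the printed one [cite: ChatterjeeDiaconis2018, §4 "Proofs", proof of
Theorem 1.1] step by step, with the i.i.d. sample realised on `(Fin n → 𝓧, μ^{⊗n})` and the
coordinate maps measure-preserving (`measurePreserving_eval`).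
* Sufficiency.  With `a = e^{L+t/2}` and the truncation `h = f·1{ρ ≤ a}`:
  `|I_n f − I f| ≤ |I_n f − I_n h| + |I_n h − I h| + |I h − I f|`; the two outer terms have
  expectation `≤ ∫_{ρ>a} |f| dν ≤ ‖f‖₂ √ν{ρ > a}` (Cauchy–Schwarz); the middle one has
  `E|I_n h − I h| ≤ √Var(I_n h) = √(Var_μ(ρh)/n) ≤ √(E_μ ρ²h²/n) ≤ √(a E_μ ρ f²/n) = ‖f‖₂ √(a/n)`
  (independence of the coordinates: `variance_sum_pi`), and `a/n ≤ e^{−t/2}` for `n ≥ e^{L+t}`.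
* Necessity.  With `a = e^{L−t/2}`: Markov under `μ` gives `μ{ρ > a} ≤ E_μ ρ / a = 1/a`, and
  `E_μ(ρ; ρ ≤ a) = ν{ρ ≤ a}`; on the complement of `{max_i ρ(X_i) > a}` the estimate `I_n(1)` is
  the truncated mean `Z = (1/n) Σ_i ρ(X_i) 1{ρ(X_i) ≤ a}`, so
  `P(I_n(1) ≥ 1−δ) ≤ n μ{ρ > a} + E Z/(1−δ) ≤ n/a + ν{ρ ≤ a}/(1−δ)`, and `n/a ≤ e^{−t/2}`.
* Thresholds vs. logarithms.  `{a < ρ} ⊆ {log a < log ρ}` exactly and `{ρ ≤ a} ⊆ {log ρ ≤ log a}`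
  `ν`-a.e. (`ρ > 0` `ν`-a.e.), with `log a = L ± t/2`; this is also why the typed `L` (a Bochner
  integral, `0` if `log ρ ∉ L¹(ν)`) needs no integrability hypothesis. -/

section Proof

open _root_.ProbabilityTheory _root_.Set

variable {μ ν : Measure 𝓧} [IsProbabilityMeasure μ] [IsProbabilityMeasure ν]

/-- marginal integral: `∫ g(x i) dμ^{⊗n} = ∫ g dμ` [folklore] -/
private lemma integral_eval (n : ℕ) (i : Fin n) {g : 𝓧 → ℝ} (hg : AEStronglyMeasurable g μ) :
    ∫ x, g (x i) ∂(Measure.pi (fun _ : Fin n => μ)) = ∫ y, g y ∂μ := by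
  have hmp := measurePreserving_eval (fun _ : Fin n => μ) i
  have h1 : ∫ y, g y ∂((Measure.pi (fun _ : Fin n => μ)).map (Function.eval i)) =
      ∫ x, g (Function.eval i x) ∂(Measure.pi (fun _ : Fin n => μ)) := by
    apply integral_map (measurable_pi_apply i).aemeasurable
    rw [hmp.map_eq]
    exact hg
  rw [hmp.map_eq] at h1
  rw [h1]

/-- marginal measure: `μ^{⊗n} {x | x i ∈ S} = μ S` [folklore] -/
private lemma measure_eval_preimage (n : ℕ) (i : Fin n) {S : Set 𝓧} (hS : MeasurableSet S) :
    (Measure.pi (fun _ : Fin n => μ)) {x | x i ∈ S} = μ S :=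
  (measurePreserving_eval (fun _ : Fin n => μ) i).measure_preimage hS.nullMeasurableSet

/-- `E|W| ≤ (E W²)^{1/2}` on a probability space, for `W ∈ L²`. [folklore] -/
private lemma integral_abs_le_sqrt_integral_sq {Ω : Type*} [MeasurableSpace Ω] {P : Measure Ω}
    [IsProbabilityMeasure P] {W : Ω → ℝ} (hW : MemLp W 2 P) :
    ∫ ω, |W ω| ∂P ≤ Real.sqrt (∫ ω, W ω ^ 2 ∂P) := by
  have h1 : MemLp (fun ω => |W ω|) (ENNReal.ofReal 2) P := by
    rw [show ENNReal.ofReal 2 = 2 by simp]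
    exact hW.abs
  have h2 : MemLp (fun _ : Ω => (1 : ℝ)) (ENNReal.ofReal 2) P := by
    simpa using (memLp_const (1 : ℝ) : MemLp (fun _ : Ω => (1 : ℝ)) 2 P)
  have h := integral_mul_le_Lp_mul_Lq_of_nonneg (μ := P) Real.HolderConjugate.two_two
    (f := fun ω => |W ω|) (g := fun _ => (1 : ℝ))
    (ae_of_all _ (fun ω => abs_nonneg _)) (ae_of_all _ (fun _ => zero_le_one)) h1 h2
  simp only [mul_one, integral_const, probReal_univ, smul_eq_mul, Real.one_rpow] at h
  have habs : ∀ ω, |W ω| ^ (2 : ℝ) = W ω ^ 2 := fun ω => by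
    rw [Real.rpow_two, sq_abs]
  simp only [habs] at h
  rw [Real.sqrt_eq_rpow]
  exact h

/-- Cauchy–Schwarz against an indicator: `∫_A |f| dν ≤ ‖f‖₂ √ν(A)`. [folklore] -/
private lemma integral_abs_indicator_le {f : 𝓧 → ℝ} (hf : MemLp f 2 ν) {A : Set 𝓧} (hA : MeasurableSet A) :
    ∫ y, |f y| * A.indicator (fun _ => (1 : ℝ)) y ∂ν ≤
      Real.sqrt (∫ y, f y ^ 2 ∂ν) * Real.sqrt (ν A).toReal := by
  have hind : MemLp (A.indicator fun _ => (1 : ℝ)) (ENNReal.ofReal 2) ν := by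
    simpa using ((memLp_const (1 : ℝ)).indicator hA : MemLp (A.indicator fun _ => (1:ℝ)) 2 ν)
  have h1 : MemLp (fun y => |f y|) (ENNReal.ofReal 2) ν := by
    rw [show ENNReal.ofReal 2 = 2 by simp]
    exact hf.abs
  have h := integral_mul_le_Lp_mul_Lq_of_nonneg (μ := ν) Real.HolderConjugate.two_two
    (f := fun y => |f y|) (g := A.indicator fun _ => (1 : ℝ))
    (ae_of_all _ (fun y => abs_nonneg _))
    (ae_of_all _ (fun y => Set.indicator_nonneg (fun _ _ => zero_le_one) y)) h1 hind
  have hsq : ∀ y, (A.indicator (fun _ => (1 : ℝ)) y) ^ (2 : ℝ) = A.indicator (fun _ => (1 : ℝ)) y := by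
    intro y
    by_cases hy : y ∈ A <;> simp [hy]
  have habs : ∀ y, |f y| ^ (2 : ℝ) = f y ^ 2 := fun y => by rw [Real.rpow_two, sq_abs]
  have hint : ∫ y, A.indicator (fun _ => (1 : ℝ)) y ∂ν = (ν A).toReal := by
    rw [integral_indicator hA, setIntegral_const, smul_eq_mul, mul_one, measureReal_def]
  simp only [hsq, habs, hint] at h
  rw [Real.sqrt_eq_rpow, Real.sqrt_eq_rpow]
  exact h

/-! ### density facts -/

/-- the density `ρ = dν/dμ` read in `ℝ` [folklore] -/
private noncomputable def dens (μ ν : Measure 𝓧) (y : 𝓧) : ℝ := (ν.rnDeriv μ y).toReal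

omit [IsProbabilityMeasure μ] [IsProbabilityMeasure ν] in
/-- `ρ ≥ 0` [folklore] -/
private lemma dens_nonneg (y : 𝓧) : 0 ≤ dens μ ν y := ENNReal.toReal_nonneg

omit [IsProbabilityMeasure μ] [IsProbabilityMeasure ν] in
/-- `ρ` is measurable [folklore] -/
private lemma measurable_dens : Measurable (dens μ ν) :=
  (Measure.measurable_rnDeriv ν μ).ennreal_toReal

/-- `∫ ρ · g dμ = ∫ g dν` [folklore] -/
private lemma integral_dens_mul (hνμ : ν ≪ μ) (g : 𝓧 → ℝ) :
    ∫ y, dens μ ν y * g y ∂μ = ∫ y, g y ∂ν :=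
  integral_toReal_rnDeriv_mul hνμ

/-- `ρ · g ∈ L¹(μ) ↔ g ∈ L¹(ν)` [folklore] -/
private lemma integrable_dens_mul_iff (hνμ : ν ≪ μ) {g : 𝓧 → ℝ} :
    Integrable (fun y => dens μ ν y * g y) μ ↔ Integrable g ν :=
  integrable_toReal_rnDeriv_mul_iff hνμ

/-- `ρ > 0` `ν`-almost everywhere [folklore] -/
private lemma dens_pos_ae (hνμ : ν ≪ μ) : ∀ᵐ y ∂ν, 0 < dens μ ν y := by
  filter_upwards [Measure.rnDeriv_pos hνμ, hνμ.ae_le (Measure.rnDeriv_lt_top ν μ)] with y h0 htop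
  exact ENNReal.toReal_pos h0.ne' htop.ne

/-- Markov for the density under `μ`: `μ{a < ρ} ≤ 1/a`. [folklore] -/
private lemma measureReal_dens_gt_le (hνμ : ν ≪ μ) {a : ℝ} (ha : 0 < a) :
    μ.real {y | a < dens μ ν y} ≤ 1 / a := by
  have hint : Integrable (dens μ ν) μ := by
    have := (integrable_dens_mul_iff (μ := μ) (ν := ν) hνμ (g := fun _ => (1 : ℝ))).mpr
      (integrable_const 1)
    simpa using this
  have hM := mul_meas_ge_le_integral_of_nonneg (ae_of_all _ (dens_nonneg (μ := μ) (ν := ν))) hint a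
  have hone : ∫ y, dens μ ν y ∂μ = 1 := by
    have := integral_dens_mul (μ := μ) (ν := ν) hνμ (fun _ => (1 : ℝ))
    simpa using this
  rw [hone] at hM
  calc μ.real {y | a < dens μ ν y} ≤ μ.real {y | a ≤ dens μ ν y} := by
        apply measureReal_mono _ (measure_ne_top _ _)
        intro y hy
        simp only [Set.mem_setOf_eq] at hy ⊢
        exact le_of_lt hy
    _ ≤ 1 / a := by
        rw [le_div_iff₀ ha, mul_comm]
        exact hM

/-! ### Part (ii): necessity -/

/-- the truncated mean weight `Z(x) = (1/n) Σ ρ(x i) 1{ρ(x i) ≤ a}` [folklore] -/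
private noncomputable def truncMean (μ ν : Measure 𝓧) (a : ℝ) (n : ℕ) (x : Fin n → 𝓧) : ℝ :=
  (1 / (n : ℝ)) * ∑ i, (Set.Iic a).indicator (fun r => r) (dens μ ν (x i))

omit [IsProbabilityMeasure μ] [IsProbabilityMeasure ν] in
/-- `Z ≥ 0` [folklore] -/
private lemma truncMean_nonneg (a : ℝ) (n : ℕ) (x : Fin n → 𝓧) : 0 ≤ truncMean μ ν a n x := by
  unfold truncMean
  apply mul_nonneg (by positivity)
  apply Finset.sum_nonneg
  intro i _
  by_cases h : dens μ ν (x i) ∈ Set.Iic a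
  · rw [Set.indicator_of_mem h]; exact dens_nonneg _
  · rw [Set.indicator_of_notMem h]

omit [IsProbabilityMeasure μ] [IsProbabilityMeasure ν] in
/-- if no weight exceeds `a`, the truncated mean IS `I_n(1)` [folklore] -/
private lemma isEstimate_one_eq_truncMean {a : ℝ} {n : ℕ} {x : Fin n → 𝓧}
    (hx : ∀ i, dens μ ν (x i) ≤ a) :
    isEstimate μ ν (fun _ => (1 : ℝ)) n x = truncMean μ ν a n x := by
  unfold isEstimate truncMean
  congr 1
  apply Finset.sum_congr rfl
  intro i _
  have hm : dens μ ν (x i) ∈ Set.Iic a := hx i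
  rw [one_mul, Set.indicator_of_mem hm]
  rfl

omit [IsProbabilityMeasure μ] [IsProbabilityMeasure ν] in
/-- `Z` is measurable [folklore] -/
private lemma measurable_truncMean (a : ℝ) (n : ℕ) : Measurable (truncMean μ ν a n) := by
  unfold truncMean
  apply Measurable.const_mul
  apply Finset.measurable_sum
  intro i _
  exact ((measurable_id.indicator measurableSet_Iic).comp measurable_dens).comp (measurable_pi_apply i)

/-- the truncated weight `ρ 1{ρ ≤ a}` is `μ`-integrable with integral `ν{ρ ≤ a}` [folklore] -/
private lemma integrable_truncWeight (hνμ : ν ≪ μ) (a : ℝ) :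
    Integrable (fun y => (Set.Iic a).indicator (fun r => r) (dens μ ν y)) μ ∧
    ∫ y, (Set.Iic a).indicator (fun r => r) (dens μ ν y) ∂μ = ν.real {y | dens μ ν y ≤ a} := by
  have hS : MeasurableSet {y | dens μ ν y ≤ a} := measurableSet_le measurable_dens measurable_const
  have heq : ∀ y, (Set.Iic a).indicator (fun r => r) (dens μ ν y) =
      dens μ ν y * {y | dens μ ν y ≤ a}.indicator (fun _ => (1:ℝ)) y := by
    intro y
    by_cases hy : dens μ ν y ≤ a
    · rw [Set.indicator_of_mem (show dens μ ν y ∈ Set.Iic a from hy),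
        Set.indicator_of_mem (show y ∈ {y | dens μ ν y ≤ a} from hy), mul_one]
    · rw [Set.indicator_of_notMem (show dens μ ν y ∉ Set.Iic a from hy),
        Set.indicator_of_notMem (show y ∉ {y | dens μ ν y ≤ a} from hy), mul_zero]
  have h1 : Integrable (fun y => dens μ ν y * {y | dens μ ν y ≤ a}.indicator (fun _ => (1:ℝ)) y) μ := by
    rw [integrable_dens_mul_iff hνμ]
    exact (integrable_const (1:ℝ)).indicator hS
  refine ⟨h1.congr (ae_of_all _ fun y => (heq y).symm), ?_⟩
  simp_rw [heq]
  rw [integral_dens_mul hνμ, integral_indicator hS, setIntegral_const, smul_eq_mul, mul_one]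

/-- `E Z ≤ ν{ρ ≤ a}` (equality for `n ≥ 1`) [folklore] -/
private lemma integral_truncMean_le (hνμ : ν ≪ μ) (a : ℝ) (n : ℕ) :
    ∫ x, truncMean μ ν a n x ∂(Measure.pi (fun _ : Fin n => μ)) ≤ ν.real {y | dens μ ν y ≤ a} := by
  obtain ⟨hg, hgint⟩ := integrable_truncWeight (μ := μ) (ν := ν) hνμ a
  rcases Nat.eq_zero_or_pos n with hn | hn
  · subst hn
    simp [truncMean]
  · have hint : ∀ i : Fin n, ∫ x, (Set.Iic a).indicator (fun r => r) (dens μ ν (x i))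
        ∂(Measure.pi (fun _ : Fin n => μ)) = ν.real {y | dens μ ν y ≤ a} := by
      intro i
      rw [integral_eval n i (g := fun y => (Set.Iic a).indicator (fun r => r) (dens μ ν y))
        hg.aestronglyMeasurable, hgint]
    have hinti : ∀ i : Fin n, Integrable (fun x : Fin n → 𝓧 =>
        (Set.Iic a).indicator (fun r => r) (dens μ ν (x i))) (Measure.pi (fun _ : Fin n => μ)) :=
      fun i => (measurePreserving_eval (fun _ : Fin n => μ) i).integrable_comp_of_integrable hg
    unfold truncMean
    rw [integral_const_mul, integral_finsetSum _ (fun i _ => hinti i)]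
    simp only [hint, Finset.sum_const, Finset.card_univ, Fintype.card_fin, nsmul_eq_mul]
    have hn' : (n : ℝ) ≠ 0 := by exact_mod_cast hn.ne'
    rw [← mul_assoc, one_div, inv_mul_cancel₀ hn', one_mul]

/-- the bad event `∃ i, a < ρ(x i)` has probability `≤ n / a` [folklore] -/
private lemma measureReal_exists_gt_le (hνμ : ν ≪ μ) {a : ℝ} (ha : 0 < a) (n : ℕ) :
    (Measure.pi (fun _ : Fin n => μ)).real {x | ∃ i, a < dens μ ν (x i)} ≤ n / a := by
  have hS : MeasurableSet {y | a < dens μ ν y} := measurableSet_lt measurable_const measurable_dens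
  have hset : {x : Fin n → 𝓧 | ∃ i, a < dens μ ν (x i)} = ⋃ i, {x | x i ∈ {y | a < dens μ ν y}} := by
    ext x; simp
  rw [hset]
  calc (Measure.pi (fun _ : Fin n => μ)).real (⋃ i, {x | x i ∈ {y | a < dens μ ν y}})
      ≤ ∑ i, (Measure.pi (fun _ : Fin n => μ)).real {x | x i ∈ {y | a < dens μ ν y}} :=
        measureReal_iUnion_fintype_le _
    _ = ∑ _i : Fin n, μ.real {y | a < dens μ ν y} := by
        apply Finset.sum_congr rfl
        intro i _
        rw [measureReal_def, measureReal_def, measure_eval_preimage n i hS]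
    _ ≤ ∑ _i : Fin n, 1 / a := Finset.sum_le_sum (fun i _ => measureReal_dens_gt_le hνμ ha)
    _ = n / a := by simp [div_eq_mul_inv]

/-- `ν{ρ ≤ a} ≤ ν{log ρ ≤ log a}` (the sets differ only on the `ν`-null set `{ρ = 0}`) [folklore] -/
private lemma measureReal_dens_le_le_log (hνμ : ν ≪ μ) (a : ℝ) :
    ν.real {y | dens μ ν y ≤ a} ≤ ν.real {y | Real.log (dens μ ν y) ≤ Real.log a} := by
  rw [measureReal_def, measureReal_def]
  apply ENNReal.toReal_mono (measure_ne_top _ _)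
  apply measure_mono_ae
  filter_upwards [dens_pos_ae (μ := μ) hνμ] with y hpos hle
  exact Real.log_le_log hpos hle

/-- **Part (ii)** in threshold form [cite: ChatterjeeDiaconis2018, §4, proof of Thm 1.1, second
half]: for `a > 0`, `δ < 1`,  `μ^{⊗n}{I_n(1) ≥ 1 − δ} ≤ n/a + ν{ρ ≤ a}/(1 − δ)`
(union bound over `{max_i ρ(X_i) > a}` plus Markov for the truncated mean). -/
private lemma partTwo (hνμ : ν ≪ μ) {a δ : ℝ} (ha : 0 < a) (hδ1 : δ < 1) (n : ℕ) :
    ((Measure.pi (fun _ : Fin n => μ)) {x | 1 - δ ≤ isEstimate μ ν (fun _ => (1:ℝ)) n x}).toReal ≤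
      n / a + ν.real {y | dens μ ν y ≤ a} / (1 - δ) := by
  set P := Measure.pi (fun _ : Fin n => μ) with hP
  have hδ' : 0 < 1 - δ := by linarith
  -- split the event
  have hsub : {x | 1 - δ ≤ isEstimate μ ν (fun _ => (1:ℝ)) n x} ⊆
      {x | ∃ i, a < dens μ ν (x i)} ∪ {x | 1 - δ ≤ truncMean μ ν a n x} := by
    intro x hx
    by_cases h : ∃ i, a < dens μ ν (x i)
    · exact Or.inl h
    · right
      push Not at h
      simp only [Set.mem_setOf_eq] at hx ⊢
      rwa [← isEstimate_one_eq_truncMean h]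
  -- Markov for the truncated mean
  have hZ : P.real {x | 1 - δ ≤ truncMean μ ν a n x} ≤ ν.real {y | dens μ ν y ≤ a} / (1 - δ) := by
    have hZint : Integrable (truncMean μ ν a n) P := by
      unfold truncMean
      apply Integrable.const_mul
      apply integrable_finsetSum _ (fun i _ => ?_)
      exact (measurePreserving_eval (fun _ : Fin n => μ) i).integrable_comp_of_integrable
        (integrable_truncWeight (μ := μ) (ν := ν) hνμ a).1
    have hM := mul_meas_ge_le_integral_of_nonneg
      (ae_of_all _ (truncMean_nonneg (μ := μ) (ν := ν) a n)) hZint (1 - δ)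
    rw [le_div_iff₀ hδ', mul_comm]
    exact le_trans hM (integral_truncMean_le hνμ a n)
  calc (P {x | 1 - δ ≤ isEstimate μ ν (fun _ => (1:ℝ)) n x}).toReal
      = P.real {x | 1 - δ ≤ isEstimate μ ν (fun _ => (1:ℝ)) n x} := rfl
    _ ≤ P.real ({x | ∃ i, a < dens μ ν (x i)} ∪ {x | 1 - δ ≤ truncMean μ ν a n x}) :=
        measureReal_mono hsub
    _ ≤ P.real {x | ∃ i, a < dens μ ν (x i)} + P.real {x | 1 - δ ≤ truncMean μ ν a n x} :=
        measureReal_union_le _ _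
    _ ≤ n / a + ν.real {y | dens μ ν y ≤ a} / (1 - δ) :=
        add_le_add (measureReal_exists_gt_le hνμ ha n) hZ

/-! ### Part (i): sufficiency -/

section PartOne

variable {f : 𝓧 → ℝ}

/-- truncated integrand `h = f · 1{ρ ≤ a}` [folklore] -/
private noncomputable def trunc (μ ν : Measure 𝓧) (f : 𝓧 → ℝ) (a : ℝ) (y : 𝓧) : ℝ :=
  {y | dens μ ν y ≤ a}.indicator f y

omit [IsProbabilityMeasure μ] [IsProbabilityMeasure ν] in
/-- `h` is measurable [folklore] -/
private lemma measurable_trunc (hf : Measurable f) (a : ℝ) : Measurable (trunc μ ν f a) :=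
  hf.indicator (measurableSet_le measurable_dens measurable_const)

omit [IsProbabilityMeasure μ] [IsProbabilityMeasure ν] in
/-- `|f − h| = |f| · 1{a < ρ}` [folklore] -/
private lemma abs_sub_trunc (f : 𝓧 → ℝ) (a : ℝ) (y : 𝓧) :
    |f y - trunc μ ν f a y| = |f y| * {y | a < dens μ ν y}.indicator (fun _ => (1:ℝ)) y := by
  unfold trunc
  by_cases hy : dens μ ν y ≤ a
  · have h1 : y ∈ {y | dens μ ν y ≤ a} := hy
    have h2 : y ∉ {y | a < dens μ ν y} := by simp only [Set.mem_setOf_eq, not_lt]; exact hy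
    rw [Set.indicator_of_mem h1, Set.indicator_of_notMem h2, sub_self, abs_zero, mul_zero]
  · have h1 : y ∉ {y | dens μ ν y ≤ a} := hy
    have h2 : y ∈ {y | a < dens μ ν y} := by simp only [Set.mem_setOf_eq]; exact lt_of_not_ge hy
    rw [Set.indicator_of_notMem h1, Set.indicator_of_mem h2, sub_zero, mul_one]

omit [IsProbabilityMeasure μ] [IsProbabilityMeasure ν] in
/-- `(h ρ)² ≤ ρ · (a f²)` pointwise [folklore] -/
private lemma trunc_mul_dens_sq_le {a : ℝ} (ha : 0 ≤ a) (f : 𝓧 → ℝ) (y : 𝓧) :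
    (trunc μ ν f a y * dens μ ν y) ^ 2 ≤ dens μ ν y * (a * f y ^ 2) := by
  unfold trunc
  by_cases hy : dens μ ν y ≤ a
  · have h1 : y ∈ {y | dens μ ν y ≤ a} := hy
    rw [Set.indicator_of_mem h1]
    have hd := dens_nonneg (μ := μ) (ν := ν) y
    calc (f y * dens μ ν y) ^ 2 = dens μ ν y * (dens μ ν y * f y ^ 2) := by ring
      _ ≤ dens μ ν y * (a * f y ^ 2) := by
          apply mul_le_mul_of_nonneg_left _ hd
          exact mul_le_mul_of_nonneg_right hy (sq_nonneg _)
  · have h1 : y ∉ {y | dens μ ν y ≤ a} := hy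
    rw [Set.indicator_of_notMem h1, zero_mul]
    have hd := dens_nonneg (μ := μ) (ν := ν) y
    have : (0:ℝ) ^ 2 = 0 := by norm_num
    rw [this]
    exact mul_nonneg hd (mul_nonneg ha (sq_nonneg _))

/-- **Part (i)** in threshold form [cite: ChatterjeeDiaconis2018, §4, proof of Thm 1.1, first
half]: for `a > 0` and `n ≥ 1`,  `E|I_n(f) − I(f)| ≤ ‖f‖₂ · (√(a/n) + 2 √ν{a < ρ})`
(truncation `h = f·1{ρ ≤ a}`, two Cauchy–Schwarz tail terms, and `Var I_n(h) ≤ (a/n)‖f‖₂²`). -/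
private lemma partOne (hνμ : ν ≪ μ) (hf : Measurable f) (hf2 : MemLp f 2 ν) {a : ℝ} (ha : 0 < a)
    {n : ℕ} (hn : 0 < n) :
    ∫ x, |isEstimate μ ν f n x - ∫ y, f y ∂ν| ∂(Measure.pi (fun _ : Fin n => μ)) ≤
      Real.sqrt (∫ y, f y ^ 2 ∂ν) *
        (Real.sqrt (a / n) + 2 * Real.sqrt (ν {y | a < dens μ ν y}).toReal) := by
  set P := Measure.pi (fun _ : Fin n => μ) with hP
  set A : Set 𝓧 := {y | a < dens μ ν y} with hA
  have hAm : MeasurableSet A := measurableSet_lt measurable_const measurable_dens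
  set F : ℝ := ∫ y, f y ^ 2 ∂ν with hF
  set h : 𝓧 → ℝ := trunc μ ν f a with hh
  have hn' : (n : ℝ) ≠ 0 := by exact_mod_cast hn.ne'
  have hnpos : (0 : ℝ) < n := by exact_mod_cast hn
  -- pointwise facts about the truncation, restated for `h`
  have habs : ∀ y, |f y - h y| = |f y| * A.indicator (fun _ => (1:ℝ)) y :=
    fun y => abs_sub_trunc f a y
  have hsq : ∀ y, (h y * dens μ ν y) ^ 2 ≤ dens μ ν y * (a * f y ^ 2) :=
    fun y => trunc_mul_dens_sq_le ha.le f y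
  -- integrability facts on 𝓧
  have hfi : Integrable f ν := hf2.integrable one_le_two
  have hhm : Measurable h := measurable_trunc hf a
  have hhi : Integrable h ν := hfi.indicator (measurableSet_le measurable_dens measurable_const)
  have hfd : Integrable (fun y => f y * dens μ ν y) μ := by
    have := (integrable_dens_mul_iff (μ := μ) hνμ).mpr hfi
    exact this.congr (ae_of_all _ fun y => mul_comm _ _)
  have hhd : Integrable (fun y => h y * dens μ ν y) μ := by
    have := (integrable_dens_mul_iff (μ := μ) hνμ).mpr hhi
    exact this.congr (ae_of_all _ fun y => mul_comm _ _)
  have hgi : Integrable (fun y => |f y| * A.indicator (fun _ => (1:ℝ)) y) ν := by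
    have : Integrable (fun y => |f y - h y|) ν := (hfi.sub hhi).abs
    exact this.congr (ae_of_all _ fun y => habs y)
  have hgd : Integrable (fun y => |f y| * A.indicator (fun _ => (1:ℝ)) y * dens μ ν y) μ := by
    have := (integrable_dens_mul_iff (μ := μ) hνμ).mpr hgi
    exact this.congr (ae_of_all _ fun y => by simp only; ring)
  -- the tail term  T := ∫ |f| 1_A dν ≤ √F √ν(A)
  set T : ℝ := ∫ y, |f y| * A.indicator (fun _ => (1:ℝ)) y ∂ν with hT
  have hT_le : T ≤ Real.sqrt F * Real.sqrt (ν A).toReal := integral_abs_indicator_le hf2 hAm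
  have hgd_int : ∫ y, |f y| * A.indicator (fun _ => (1:ℝ)) y * dens μ ν y ∂μ = T := by
    rw [hT, ← integral_dens_mul hνμ]
    exact integral_congr_ae (ae_of_all _ fun y => by simp only; ring)
  -- L² fact for h·ρ under μ and the variance bound  Var_μ(hρ) ≤ a F
  have hhd2 : MemLp (fun y => h y * dens μ ν y) 2 μ := by
    have hmeas2 : AEStronglyMeasurable (fun y => h y * dens μ ν y) μ :=
      (hhm.mul measurable_dens).aestronglyMeasurable
    rw [memLp_two_iff_integrable_sq hmeas2]
    have hdom : Integrable (fun y => dens μ ν y * (a * f y ^ 2)) μ :=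
      (integrable_dens_mul_iff (μ := μ) hνμ).mpr (hf2.integrable_sq.const_mul a)
    refine hdom.mono' ((hhm.mul measurable_dens).pow_const 2).aestronglyMeasurable
      (ae_of_all _ fun y => ?_)
    rw [Real.norm_eq_abs, abs_of_nonneg (sq_nonneg _)]
    exact hsq y
  have hvar_le : Var[fun y => h y * dens μ ν y; μ] ≤ a * F := by
    refine le_trans (variance_le_expectation_sq (hhm.mul measurable_dens).aestronglyMeasurable) ?_
    calc ∫ y, ((fun y => h y * dens μ ν y) ^ 2) y ∂μ
        ≤ ∫ y, dens μ ν y * (a * f y ^ 2) ∂μ := by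
          apply integral_mono_of_nonneg (ae_of_all _ fun y => sq_nonneg _)
            ((integrable_dens_mul_iff (μ := μ) hνμ).mpr (hf2.integrable_sq.const_mul a))
            (ae_of_all _ fun y => hsq y)
      _ = a * F := by rw [integral_dens_mul hνμ, integral_const_mul]
  -- the sum S = Σ_i h(x i) ρ(x i) under P
  have hY2 : ∀ i : Fin n, MemLp (fun x : Fin n → 𝓧 => h (x i) * dens μ ν (x i)) 2 P := fun i =>
    hhd2.comp_measurePreserving (measurePreserving_eval (fun _ : Fin n => μ) i)
  have hYint : ∀ i : Fin n, ∫ x, h (x i) * dens μ ν (x i) ∂P = ∫ y, h y ∂ν := by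
    intro i
    rw [integral_eval n i (g := fun y => h y * dens μ ν y) hhd.aestronglyMeasurable,
      ← integral_dens_mul hνμ h]
    exact integral_congr_ae (ae_of_all _ fun y => mul_comm _ _)
  set S : (Fin n → 𝓧) → ℝ := ∑ i : Fin n, fun x => h (x i) * dens μ ν (x i) with hS
  have hS_apply : ∀ x, S x = ∑ i, h (x i) * dens μ ν (x i) := fun x => by
    simp only [hS, Finset.sum_apply]
  have hS2 : MemLp S 2 P := memLp_finsetSum' _ (fun i _ => hY2 i)
  have hSvar : Var[S; P] ≤ n * (a * F) := by
    rw [hS, hP, variance_sum_pi (X := fun _ : Fin n => fun y => h y * dens μ ν y) (fun _ => hhd2)]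
    calc ∑ _i : Fin n, Var[fun y => h y * dens μ ν y; μ] ≤ ∑ _i : Fin n, a * F :=
          Finset.sum_le_sum fun i _ => hvar_le
      _ = n * (a * F) := by simp
  have hSint : ∫ x, S x ∂P = n * ∫ y, h y ∂ν := by
    simp_rw [hS_apply]
    rw [integral_finsetSum _ (fun i _ => (hY2 i).integrable one_le_two)]
    simp only [hYint, Finset.sum_const, Finset.card_univ, Fintype.card_fin, nsmul_eq_mul]
  -- I_n h = S / n  and  E|I_n h − I h| ≤ √(a/n) √F
  have hInh : ∀ x, isEstimate μ ν h n x = (1 / (n:ℝ)) * S x := by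
    intro x; rw [hS_apply]; rfl
  have hmid : ∫ x, |isEstimate μ ν h n x - ∫ y, h y ∂ν| ∂P ≤ Real.sqrt (a / n) * Real.sqrt F := by
    have hcen : MemLp (fun x => S x - ∫ x, S x ∂P) 2 P := hS2.sub (memLp_const _)
    have h1 : ∫ x, |S x - ∫ x, S x ∂P| ∂P ≤ Real.sqrt (∫ x, (S x - ∫ x, S x ∂P) ^ 2 ∂P) :=
      integral_abs_le_sqrt_integral_sq hcen
    have h2 : ∫ x, (S x - ∫ x, S x ∂P) ^ 2 ∂P = Var[S; P] :=
      (variance_eq_integral hS2.aemeasurable).symm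
    have heq : ∀ x, |isEstimate μ ν h n x - ∫ y, h y ∂ν| =
        (1 / (n:ℝ)) * |S x - ∫ x, S x ∂P| := by
      intro x
      have hre : (1 / (n:ℝ)) * (S x - n * ∫ y, h y ∂ν) = (1 / (n:ℝ)) * S x - ∫ y, h y ∂ν := by
        rw [mul_sub, ← mul_assoc, one_div_mul_cancel hn', one_mul]
      rw [hInh, hSint, ← hre, abs_mul, abs_of_pos (by positivity : (0:ℝ) < 1 / n)]
    simp_rw [heq]
    rw [integral_const_mul]
    calc 1 / (n:ℝ) * ∫ x, |S x - ∫ x, S x ∂P| ∂P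
        ≤ 1 / (n:ℝ) * Real.sqrt (Var[S; P]) := by
          apply mul_le_mul_of_nonneg_left _ (by positivity)
          rw [← h2]; exact h1
      _ ≤ 1 / (n:ℝ) * Real.sqrt (n * (a * F)) := by gcongr
      _ = Real.sqrt (a / n) * Real.sqrt F := by
          rw [← Real.sqrt_mul (show (0:ℝ) ≤ a / n by positivity) F,
            show a / n * F = (1 / (n:ℝ)) ^ 2 * (n * (a * F)) by field_simp,
            Real.sqrt_mul (by positivity : (0:ℝ) ≤ (1 / (n:ℝ)) ^ 2), Real.sqrt_sq (by positivity)]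
  -- integrability of the estimates under P
  have hI : ∀ g : 𝓧 → ℝ, Integrable (fun y => g y * dens μ ν y) μ →
      Integrable (isEstimate μ ν g n) P := by
    intro g hg
    unfold isEstimate
    apply Integrable.const_mul
    apply integrable_finsetSum _ (fun i _ => ?_)
    exact (measurePreserving_eval (fun _ : Fin n => μ) i).integrable_comp_of_integrable hg
  -- first term: E|I_n f − I_n h| ≤ T
  have hfirst : ∫ x, |isEstimate μ ν f n x - isEstimate μ ν h n x| ∂P ≤ T := by
    have hpt : ∀ x, |isEstimate μ ν f n x - isEstimate μ ν h n x| ≤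
        (1 / (n:ℝ)) * ∑ i, |f (x i)| * A.indicator (fun _ => (1:ℝ)) (x i) * dens μ ν (x i) := by
      intro x
      simp only [isEstimate]
      rw [← mul_sub, ← Finset.sum_sub_distrib, abs_mul,
        abs_of_pos (by positivity : (0:ℝ) < 1 / n)]
      apply mul_le_mul_of_nonneg_left _ (by positivity)
      refine le_trans (Finset.abs_sum_le_sum_abs _ _) (Finset.sum_le_sum fun i _ => ?_)
      rw [← sub_mul, abs_mul, abs_of_nonneg ENNReal.toReal_nonneg, habs (x i)]
      exact le_rfl
    have hGi : ∀ i : Fin n, Integrable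
        (fun x : Fin n → 𝓧 => |f (x i)| * A.indicator (fun _ => (1:ℝ)) (x i) * dens μ ν (x i)) P :=
      fun i => (measurePreserving_eval (fun _ : Fin n => μ) i).integrable_comp_of_integrable hgd
    have hGint : ∀ i : Fin n,
        ∫ x, |f (x i)| * A.indicator (fun _ => (1:ℝ)) (x i) * dens μ ν (x i) ∂P = T := by
      intro i
      rw [integral_eval n i (g := fun y => |f y| * A.indicator (fun _ => (1:ℝ)) y * dens μ ν y)
        hgd.aestronglyMeasurable, hgd_int]
    calc ∫ x, |isEstimate μ ν f n x - isEstimate μ ν h n x| ∂P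
        ≤ ∫ x, (1 / (n:ℝ)) * ∑ i, |f (x i)| * A.indicator (fun _ => (1:ℝ)) (x i) * dens μ ν (x i) ∂P :=
          integral_mono_of_nonneg (ae_of_all _ fun _ => abs_nonneg _)
            ((integrable_finsetSum _ (fun i _ => hGi i)).const_mul _) (ae_of_all _ hpt)
      _ = T := by
          rw [integral_const_mul, integral_finsetSum _ (fun i _ => hGi i)]
          simp only [hGint, Finset.sum_const, Finset.card_univ, Fintype.card_fin, nsmul_eq_mul]
          rw [← mul_assoc, one_div_mul_cancel hn', one_mul]
  -- last term: |I h − I f| ≤ T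
  have hlast : |(∫ y, h y ∂ν) - ∫ y, f y ∂ν| ≤ T := by
    rw [← integral_sub hhi hfi]
    refine le_trans abs_integral_le_integral_abs (le_of_eq ?_)
    exact integral_congr_ae (ae_of_all _ fun y => by simp only; rw [abs_sub_comm, habs])
  -- assembly
  have h3 : ∀ x, |isEstimate μ ν f n x - ∫ y, f y ∂ν| ≤
      |isEstimate μ ν f n x - isEstimate μ ν h n x| +
        (|isEstimate μ ν h n x - ∫ y, h y ∂ν| + |(∫ y, h y ∂ν) - ∫ y, f y ∂ν|) := by
    intro x
    calc |isEstimate μ ν f n x - ∫ y, f y ∂ν|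
        ≤ |isEstimate μ ν f n x - isEstimate μ ν h n x| + |isEstimate μ ν h n x - ∫ y, f y ∂ν| :=
          abs_sub_le _ _ _
      _ ≤ _ := by gcongr; exact abs_sub_le _ _ _
  have hi1 : Integrable (fun x => |isEstimate μ ν f n x - isEstimate μ ν h n x|) P :=
    ((hI f hfd).sub (hI h hhd)).abs
  have hi2 : Integrable (fun x => |isEstimate μ ν h n x - ∫ y, h y ∂ν|) P :=
    ((hI h hhd).sub (integrable_const _)).abs
  have hi23 : Integrable (fun x => |isEstimate μ ν h n x - ∫ y, h y ∂ν| +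
      |(∫ y, h y ∂ν) - ∫ y, f y ∂ν|) P := hi2.add (integrable_const _)
  have hsum : ∫ x, |isEstimate μ ν f n x - ∫ y, f y ∂ν| ∂P ≤
      T + (Real.sqrt (a / n) * Real.sqrt F + T) := by
    calc ∫ x, |isEstimate μ ν f n x - ∫ y, f y ∂ν| ∂P
        ≤ ∫ x, |isEstimate μ ν f n x - isEstimate μ ν h n x| +
            (|isEstimate μ ν h n x - ∫ y, h y ∂ν| + |(∫ y, h y ∂ν) - ∫ y, f y ∂ν|) ∂P :=
          integral_mono_of_nonneg (ae_of_all _ fun _ => abs_nonneg _)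
            (hi1.add hi23) (ae_of_all _ h3)
      _ = ∫ x, |isEstimate μ ν f n x - isEstimate μ ν h n x| ∂P +
            (∫ x, |isEstimate μ ν h n x - ∫ y, h y ∂ν| ∂P + |(∫ y, h y ∂ν) - ∫ y, f y ∂ν|) := by
          rw [integral_add hi1 hi23, integral_add hi2 (integrable_const _),
            integral_const, probReal_univ, one_smul]
      _ ≤ T + (Real.sqrt (a / n) * Real.sqrt F + T) := by gcongr
  have hre : Real.sqrt F * (Real.sqrt (a / n) + 2 * Real.sqrt (ν A).toReal) =
      Real.sqrt (a / n) * Real.sqrt F + 2 * (Real.sqrt F * Real.sqrt (ν A).toReal) := by ring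
  rw [hre]
  linarith

end PartOne

/-- **Discharge** of the named fact: Theorem 1.1 of [cite: ChatterjeeDiaconis2018, Thm 1.1] holds
as typed (`ChatterjeeDiaconis2018_sampleSize`), by the printed proof (§4 of the paper). -/
theorem ChatterjeeDiaconis2018_sampleSize_holds : ChatterjeeDiaconis2018_sampleSize := by
  intro 𝓧 _ μ ν _ _ hνμ f hf hf2 t ht
  obtain ⟨L, hL⟩ : ∃ L : ℝ, L = ∫ y, Real.log (ν.rnDeriv μ y).toReal ∂ν := ⟨_, rfl⟩
  rw [← hL]
  refine ⟨fun n hn => ?_, fun n hn δ _ hδ1 => ?_⟩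
  · -- sufficiency: threshold a = e^{L + t/2}
    obtain ⟨a, ha_def⟩ : ∃ a : ℝ, a = Real.exp (L + t / 2) := ⟨_, rfl⟩
    have ha : 0 < a := by rw [ha_def]; exact Real.exp_pos _
    have hnR : (0:ℝ) < n := lt_of_lt_of_le (Real.exp_pos _) hn
    have hnpos : 0 < n := by exact_mod_cast hnR
    have key := partOne (μ := μ) (ν := ν) hνμ hf hf2 ha hnpos
    have h1 : Real.sqrt (a / n) ≤ Real.exp (-t / 4) := by
      have han : a / n ≤ Real.exp (-t / 2) := by
        rw [div_le_iff₀ hnR]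
        calc a = Real.exp (-t / 2) * Real.exp (L + t) := by
              rw [ha_def, ← Real.exp_add]; congr 1; ring
          _ ≤ Real.exp (-t / 2) * n := by gcongr
      have hsq : Real.exp (-t / 2) = Real.exp (-t / 4) ^ 2 := by
        rw [sq, ← Real.exp_add]; congr 1; ring
      calc Real.sqrt (a / n) ≤ Real.sqrt (Real.exp (-t / 2)) := Real.sqrt_le_sqrt han
        _ = Real.exp (-t / 4) := by rw [hsq, Real.sqrt_sq (Real.exp_pos _).le]
    have h2 : (ν {y | a < dens μ ν y}).toReal ≤
        (ν {y | L + t / 2 < Real.log (ν.rnDeriv μ y).toReal}).toReal := by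
      apply ENNReal.toReal_mono (measure_ne_top _ _)
      apply measure_mono
      intro y hy
      simp only [Set.mem_setOf_eq] at hy ⊢
      have hlog : Real.log a = L + t / 2 := by rw [ha_def, Real.log_exp]
      rw [← hlog]
      exact Real.log_lt_log ha hy
    refine le_trans key (mul_le_mul_of_nonneg_left ?_ (Real.sqrt_nonneg _))
    exact add_le_add h1 (mul_le_mul_of_nonneg_left (Real.sqrt_le_sqrt h2) zero_le_two)
  · -- necessity: threshold a = e^{L − t/2}
    obtain ⟨a, ha_def⟩ : ∃ a : ℝ, a = Real.exp (L - t / 2) := ⟨_, rfl⟩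
    have ha : 0 < a := by rw [ha_def]; exact Real.exp_pos _
    have hδ' : 0 < 1 - δ := by linarith
    have key := partTwo (μ := μ) (ν := ν) hνμ ha hδ1 n
    have h1 : (n:ℝ) / a ≤ Real.exp (-t / 2) := by
      rw [div_le_iff₀ ha]
      calc (n:ℝ) ≤ Real.exp (L - t) := hn
        _ = Real.exp (-t / 2) * a := by rw [ha_def, ← Real.exp_add]; congr 1; ring
    have h2 : ν.real {y | dens μ ν y ≤ a} ≤
        (ν {y | Real.log (ν.rnDeriv μ y).toReal ≤ L - t / 2}).toReal := by
      have hlog : Real.log a = L - t / 2 := by rw [ha_def, Real.log_exp]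
      have := measureReal_dens_le_le_log (μ := μ) hνμ a
      rw [hlog] at this
      exact this
    exact le_trans key (add_le_add h1 (div_le_div_of_nonneg_right h2 hδ'.le))

end Proof

end Literature.Probability.ImportanceSampling
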